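import Summits.QuantumFields.YangMills.Theorems.ColdStartUniversalityLatticeLangevinGradientBoundCalculus
import Summits.QuantumFields.YangMills.Theorems.ColdStartUniversalityLatticeLangevinFramePointwiseBochner
import HarnessLib

/-!
# Route `ColdStartUniversality` (fixed-cut-off package, Bakry–Émery side, GRADIENT half): the POINTWISE curvature inequality
# `𝓛Γ(u) − 2Γ(u, 𝓛u) ≥ (2 − K₀)·Γ(u)` on `SU(2)^E`

Helper file (seat `ym-line-csu-p1`, g29; `--supports stmt-QuantumFields-24809`).  Second groundwork file for the weak gradient commutation
`Γ(P_t f) ≤ e^(−2ρt) P_t Γ(f)` of the SU(2) lattice Langevin (SZZ) semigroup at a fixed cut-off (sequel of `…GradientBoundCalculus`).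
With `coords`, `gen = 𝓛_(β')`, the noise covariance `A` and the coordinate carré du champ `Γ^A(u,w)(V) = Σ_(ij) ∂_iu ∂_jw A_(ij)(V)`:
★★ `generator_carre_sub_ge_of_hessBound` — THE POINTWISE `CD(1 − K₀/2, ∞)` INEQUALITY on the group: if the frame Hessian of the
  plaquette function is bounded by `K₀` (hypothesis `hHess` of `…BakryEmeryCurvature`, `K₀ = 24|β'|` by `wilson_hessBound`), then for
  `u ∈ C³` and any `C²` ambient representative `v` of `𝓛u` on the group,
  `(2 − K₀)·Γ^A(u)(V) ≤ 𝓛(Σ_n (W_nu)²)(V) − 2Γ^A(u,v)(V)` at EVERY configuration `V` (pointwise Bochner `frameGammaTwo_pointwise` +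
  Ricci identity of the noise frame + `quarter_sum_sum_sq_bracket_le` + the Hessian bound).
THEOREMS ONLY, no definition, no sorry.  HONEST FRAMING: fixed cut-off; pointwise calculus, no statement about the route's scaling
`β'_K → ∞`; nothing K-uniform; no crux, rung or summit statement is proved; the Yang–Mills mass gap is NOT proved.
-/

set_option autoImplicit false

noncomputable section

namespace Summit.QuantumFields.YangMills.Theorems.ColdStartUniversality

open MeasureTheory Matrix Complex Finset
open scoped ComplexConjugate BigOperators Matrix
open Literature.MathematicalPhysics.QuantumFieldTheory
open Literature.MathematicalPhysics.QuantumLattice (fundamentalRep fundamentalLatticeRep continuous_fundamentalRep fundamentalRep_apply)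

variable {L : ℕ} [NeZero L]

/-! ## §4. The pointwise curvature inequality on the group -/

/-- ★★ **Pointwise `CD(1 − K₀/2, ∞)` for the SZZ generator on `SU(2)^E`.**  If the frame Hessian of the plaquette function is bounded by
`K₀` times the carré du champ at every configuration, then for every `C³` function `u` of the real link coordinates and every `C²`
function `v` representing `𝓛u` on the group (`v∘coords = 𝓛u`), at EVERY configuration `V`:
`(2 − K₀)·Γ^A(u)(V) ≤ 𝓛(Σ_n (W_nu)²)(V) − 2·Γ^A(u,v)(V)`
— Bakry–Émery's `Γ₂(u) ≥ ρΓ(u)`, `ρ = 1 − K₀/2`, written with the tree's coordinate generator (whose carré du champ is `½Γ^A`).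
[cite: BakryGentilLedoux2014, (1.16.3), (C.5.3) and Prop. 3.3.18; ShenZhuZhu2022 §4 (4.7)–(4.8)] -/
theorem generator_carre_sub_ge_of_hessBound (L : ℕ) [NeZero L] (β' K₀ : ℝ)
    (hHess : (∀ (V : (GaugeConfig 3 L (Matrix.specialUnitaryGroup (Fin 2) ℂ))) (Λ : (Edge 3 L × Fin (fundamentalLatticeRep 2).N × Fin (fundamentalLatticeRep 2).N × Bool → ℝ) →L[ℝ] ℝ),
      ∑ n : Edge 3 L × NoiseIdx (fundamentalLatticeRep 2).N, ∑ m : Edge 3 L × NoiseIdx (fundamentalLatticeRep 2).N,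
        Λ ((fun q : Edge 3 L × Fin (fundamentalLatticeRep 2).N × Fin (fundamentalLatticeRep 2).N × Bool => if n.1 = q.1 then (fun z : ℂ => if q.2.2.2 then z.im else z.re) (((Real.sqrt 2 : ℂ) • ((fundamentalLatticeRep 2).lieProj (noiseDir n.2) * (fun (ee : Edge 3 L) => Matrix.of fun (i j : Fin (fundamentalLatticeRep 2).N) => (((fun (V : GaugeConfig 3 L (Matrix.specialUnitaryGroup (Fin 2) ℂ)) (q : Edge 3 L × Fin (fundamentalLatticeRep 2).N × Fin (fundamentalLatticeRep 2).N × Bool) => (fun z : ℂ => if q.2.2.2 then z.im else z.re) ((fundamentalRep (Fin 2) (V q.1) : Matrix (Fin 2) (Fin 2) ℂ) q.2.1 q.2.2.1)) V (ee, i, j, false) : ℝ) : ℂ) + (((fun (V : GaugeConfig 3 L (Matrix.specialUnitaryGroup (Fin 2) ℂ)) (q : Edge 3 L × Fin (fundamentalLatticeRep 2).N × Fin (fundamentalLatticeRep 2).N × Bool) => (fun z : ℂ => if q.2.2.2 then z.im else z.re) ((fundamentalRep (Fin 2) (V q.1) : Matrix (Fin 2) (Fin 2) ℂ) q.2.1 q.2.2.1))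 V (ee, i, j, true) : ℝ) : ℂ) * Complex.I) q.1)) q.2.1 q.2.2.1) else 0)) * Λ ((fun q : Edge 3 L × Fin (fundamentalLatticeRep 2).N × Fin (fundamentalLatticeRep 2).N × Bool => if m.1 = q.1 then (fun z : ℂ => if q.2.2.2 then z.im else z.re) (((Real.sqrt 2 : ℂ) • ((fundamentalLatticeRep 2).lieProj (noiseDir m.2) * (fun (ee : Edge 3 L) => Matrix.of fun (i j : Fin (fundamentalLatticeRep 2).N) => (((fun (V : GaugeConfig 3 L (Matrix.specialUnitaryGroup (Fin 2) ℂ)) (q : Edge 3 L × Fin (fundamentalLatticeRep 2).N × Fin (fundamentalLatticeRep 2).N × Bool) => (fun z : ℂ => if q.2.2.2 then z.im else z.re) ((fundamentalRep (Fin 2) (V q.1) : Matrix (Fin 2) (Fin 2) ℂ) q.2.1 q.2.2.1)) V (ee, i, j, false) : ℝ) : ℂ) + (((fun (V : GaugeConfig 3 L (Matrix.specialUnitaryGroup (Fin 2) ℂ)) (q : Edge 3 L × Fin (fundamentalLatticeRep 2).N × Fin (fundamentalLatticeRep 2).N × Bool) => (fun z : ℂ => if q.2.2.2 then z.im else z.re)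 ((fundamentalRep (Fin 2) (V q.1) : Matrix (Fin 2) (Fin 2) ℂ) q.2.1 q.2.2.1)) V (ee, i, j, true) : ℝ) : ℂ) * Complex.I) q.1)) q.2.1 q.2.2.1) else 0)) *
          fderiv ℝ (fun z : (Edge 3 L × Fin (fundamentalLatticeRep 2).N × Fin (fundamentalLatticeRep 2).N × Bool → ℝ) => fderiv ℝ (fun y : (Edge 3 L × Fin (fundamentalLatticeRep 2).N × Fin (fundamentalLatticeRep 2).N × Bool → ℝ) => β' * ∑ p : Plaquette 3 L, (rootedLoop (fun (ee : Edge 3 L) (i j : Fin (fundamentalLatticeRep 2).N) => ((y (ee, i, j, false) : ℝ) : ℂ) + ((y (ee, i, j, true) : ℝ) : ℂ) * Complex.I) (p.1, p.2.1.1) p.2.1.2 false).trace.re) z (fun q : Edge 3 L × Fin (fundamentalLatticeRep 2).N × Fin (fundamentalLatticeRep 2).N × Bool => if m.1 = q.1 then (fun z : ℂ => if q.2.2.2 then z.im else z.re) (((Real.sqrt 2 : ℂ) • ((fundamentalLatticeRep 2).lieProj (noiseDir m.2) * (fun (ee : Edge 3 L) => Matrix.of fun (i j : Fin (fundamentalLatticeRep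 2).N) => ((z (ee, i, j, false) : ℝ) : ℂ) + ((z (ee, i, j, true) : ℝ) : ℂ) * Complex.I) q.1)) q.2.1 q.2.2.1) else 0)) ((fun (V : GaugeConfig 3 L (Matrix.specialUnitaryGroup (Fin 2) ℂ)) (q : Edge 3 L × Fin (fundamentalLatticeRep 2).N × Fin (fundamentalLatticeRep 2).N × Bool) => (fun z : ℂ => if q.2.2.2 then z.im else z.re) ((fundamentalRep (Fin 2) (V q.1) : Matrix (Fin 2) (Fin 2) ℂ) q.2.1 q.2.2.1)) V) (fun q : Edge 3 L × Fin (fundamentalLatticeRep 2).N × Fin (fundamentalLatticeRep 2).N × Bool => if n.1 = q.1 then (fun z : ℂ => if q.2.2.2 then z.im else z.re) (((Real.sqrt 2 : ℂ) • ((fundamentalLatticeRep 2).lieProj (noiseDir n.2) * (fun (ee : Edge 3 L) => Matrix.of fun (i j : Fin (fundamentalLatticeRep 2).N) => (((fun (V : GaugeConfig 3 L (Matrix.specialUnitaryGroup (Fin 2) ℂ)) (q : Edge 3 L × Fin (fundamentalLatticeRep 2).N × Fin (fundamentalLatticeRep 2).N × Bool) => (fun z : ℂ => if q.2.2.2 then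 z.im else z.re) ((fundamentalRep (Fin 2) (V q.1) : Matrix (Fin 2) (Fin 2) ℂ) q.2.1 q.2.2.1)) V (ee, i, j, false) : ℝ) : ℂ) + (((fun (V : GaugeConfig 3 L (Matrix.specialUnitaryGroup (Fin 2) ℂ)) (q : Edge 3 L × Fin (fundamentalLatticeRep 2).N × Fin (fundamentalLatticeRep 2).N × Bool) => (fun z : ℂ => if q.2.2.2 then z.im else z.re) ((fundamentalRep (Fin 2) (V q.1) : Matrix (Fin 2) (Fin 2) ℂ) q.2.1 q.2.2.1)) V (ee, i, j, true) : ℝ) : ℂ) * Complex.I) q.1)) q.2.1 q.2.2.1) else 0)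
        ≤ K₀ * ∑ n : Edge 3 L × NoiseIdx (fundamentalLatticeRep 2).N, (Λ (fun q : Edge 3 L × Fin (fundamentalLatticeRep 2).N × Fin (fundamentalLatticeRep 2).N × Bool => if n.1 = q.1 then (fun z : ℂ => if q.2.2.2 then z.im else z.re) (((Real.sqrt 2 : ℂ) • ((fundamentalLatticeRep 2).lieProj (noiseDir n.2) * (fun (ee : Edge 3 L) => Matrix.of fun (i j : Fin (fundamentalLatticeRep 2).N) => (((fun (V : GaugeConfig 3 L (Matrix.specialUnitaryGroup (Fin 2) ℂ)) (q : Edge 3 L × Fin (fundamentalLatticeRep 2).N × Fin (fundamentalLatticeRep 2).N × Bool) => (fun z : ℂ => if q.2.2.2 then z.im else z.re) ((fundamentalRep (Fin 2) (V q.1) : Matrix (Fin 2) (Fin 2) ℂ) q.2.1 q.2.2.1)) V (ee, i, j, false) : ℝ) : ℂ) + (((fun (V : GaugeConfig 3 L (Matrix.specialUnitaryGroup (Fin 2) ℂ)) (q : Edge 3 L × Fin (fundamentalLatticeRep 2).N × Fin (fundamentalLatticeRep 2).N × Bool) => (fun z : ℂ => if q.2.2.2 then z.im else z.re) ((fundamentalRep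 (Fin 2) (V q.1) : Matrix (Fin 2) (Fin 2) ℂ) q.2.1 q.2.2.1)) V (ee, i, j, true) : ℝ) : ℂ) * Complex.I) q.1)) q.2.1 q.2.2.1) else 0)) ^ 2))
    {u v : (Edge 3 L × Fin 2 × Fin 2 × Bool → ℝ) → ℝ} (hu : ContDiff ℝ 3 u) (hv : ContDiff ℝ 2 v) :
    let coords : GaugeConfig 3 L (Matrix.specialUnitaryGroup (Fin 2) ℂ) → (Edge 3 L × Fin 2 × Fin 2 × Bool → ℝ) :=
      fun V q => (fun z : ℂ => if q.2.2.2 then z.im else z.re)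
        ((fundamentalRep (Fin 2) (V q.1) : Matrix (Fin 2) (Fin 2) ℂ) q.2.1 q.2.2.1)
    let A : GaugeConfig 3 L (Matrix.specialUnitaryGroup (Fin 2) ℂ) → (Edge 3 L × Fin 2 × Fin 2 × Bool) →
        (Edge 3 L × Fin 2 × Fin 2 × Bool) → ℝ := fun V i j =>
      ∑ n : Edge 3 L × NoiseIdx 2,
        (if n.1 = i.1 then (fun z : ℂ => if i.2.2.2 then z.im else z.re)
          ((latticeLangevinDynamics (fundamentalLatticeRep 2) β').noise
            (matrixConfig (fundamentalRep (Fin 2)) V) i.1 n.2 i.2.1 i.2.2.1) else 0) *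
        (if n.1 = j.1 then (fun z : ℂ => if j.2.2.2 then z.im else z.re)
          ((latticeLangevinDynamics (fundamentalLatticeRep 2) β').noise
            (matrixConfig (fundamentalRep (Fin 2)) V) j.1 n.2 j.2.1 j.2.2.1) else 0)
    let gen : ((Edge 3 L × Fin 2 × Fin 2 × Bool → ℝ) → ℝ) → GaugeConfig 3 L (Matrix.specialUnitaryGroup (Fin 2) ℂ) → ℝ :=
      fun h V =>
      (∑ i : Edge 3 L × Fin 2 × Fin 2 × Bool, fderiv ℝ h (coords V) (Pi.single i 1) *
          (fun z : ℂ => if i.2.2.2 then z.im else z.re)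
            ((latticeLangevinDynamics (fundamentalLatticeRep 2) β').drift
              (matrixConfig (fundamentalRep (Fin 2)) V) i.1 i.2.1 i.2.2.1) +
      1 / 2 * ∑ i : Edge 3 L × Fin 2 × Fin 2 × Bool, ∑ j : Edge 3 L × Fin 2 × Fin 2 × Bool,
        fderiv ℝ (fun z => fderiv ℝ h z (Pi.single i 1)) (coords V) (Pi.single j 1) *
          ∑ n : Edge 3 L × NoiseIdx 2,
            (if n.1 = i.1 then (fun z : ℂ => if i.2.2.2 then z.im else z.re)
              ((latticeLangevinDynamics (fundamentalLatticeRep 2) β').noise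
                (matrixConfig (fundamentalRep (Fin 2)) V) i.1 n.2 i.2.1 i.2.2.1) else 0) *
            (if n.1 = j.1 then (fun z : ℂ => if j.2.2.2 then z.im else z.re)
              ((latticeLangevinDynamics (fundamentalLatticeRep 2) β').noise
                (matrixConfig (fundamentalRep (Fin 2)) V) j.1 n.2 j.2.1 j.2.2.1) else 0))
    (∀ V, v (coords V) = gen u V) → ∀ V,
      (2 - K₀) * ∑ i : Edge 3 L × Fin 2 × Fin 2 × Bool, ∑ j : Edge 3 L × Fin 2 × Fin 2 × Bool,
          fderiv ℝ u (coords V) (Pi.single i 1) * fderiv ℝ u (coords V) (Pi.single j 1) * A V i j ≤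
        gen (fun y : (Edge 3 L × Fin 2 × Fin 2 × Bool → ℝ) => ∑ n : Edge 3 L × NoiseIdx (fundamentalLatticeRep 2).N, (fderiv ℝ u y (fun q : Edge 3 L × Fin (fundamentalLatticeRep 2).N × Fin (fundamentalLatticeRep 2).N × Bool => if n.1 = q.1 then (fun z : ℂ => if q.2.2.2 then z.im else z.re) (((Real.sqrt 2 : ℂ) • ((fundamentalLatticeRep 2).lieProj (noiseDir n.2) * (fun (ee : Edge 3 L) => Matrix.of fun (i j : Fin (fundamentalLatticeRep 2).N) => ((y (ee, i, j, false) : ℝ) : ℂ) + ((y (ee, i, j, true) : ℝ) : ℂ) * Complex.I) q.1)) q.2.1 q.2.2.1) else 0)) ^ 2) V -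
          2 * ∑ i : Edge 3 L × Fin 2 × Fin 2 × Bool, ∑ j : Edge 3 L × Fin 2 × Fin 2 × Bool,
            fderiv ℝ u (coords V) (Pi.single i 1) * fderiv ℝ v (coords V) (Pi.single j 1) * A V i j := by
  intro coords A gen huv V
  classical
  obtain ⟨s, c, hs, hbr, hanti, hRic, hCas⟩ := exists_noiseFrame L
  set s2 : (Edge 3 L × NoiseIdx (fundamentalLatticeRep 2).N) → ((Edge 3 L × Fin 2 × Fin 2 × Bool → ℝ) →L[ℝ] (Edge 3 L × Fin 2 × Fin 2 × Bool → ℝ)) := s with hs2def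
  set ψ : (Edge 3 L × Fin 2 × Fin 2 × Bool → ℝ) → ℝ := (fun y : (Edge 3 L × Fin 2 × Fin 2 × Bool → ℝ) => β' * ∑ p : Plaquette 3 L, (rootedLoop (fun (ee : Edge 3 L) (i j : Fin 2) => ((y (ee, i, j, false) : ℝ) : ℂ) + ((y (ee, i, j, true) : ℝ) : ℂ) * Complex.I) (p.1, p.2.1.1) p.2.1.2 false).trace.re) with hψ
  have hψC : ContDiff ℝ 2 ψ := (contDiff_psiHat (d := 3) (L := L) (N := (fundamentalLatticeRep 2).N) β').of_le le_top
  have hu2 : ContDiff ℝ 2 u := hu.of_le (by norm_num)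
  have hbr2 : ∀ (n m : Edge 3 L × NoiseIdx (fundamentalLatticeRep 2).N) (y : (Edge 3 L × Fin 2 × Fin 2 × Bool → ℝ)), s2 m (s2 n y) - s2 n (s2 m y) = ∑ k, c n m k • s2 k y :=
    fun n m y => hbr n m y
  have hs2 : ∀ (n : Edge 3 L × NoiseIdx (fundamentalLatticeRep 2).N) (y : (Edge 3 L × Fin 2 × Fin 2 × Bool → ℝ)), s2 n y = (fun q : Edge 3 L × Fin (fundamentalLatticeRep 2).N × Fin (fundamentalLatticeRep 2).N × Bool => if n.1 = q.1 then (fun z : ℂ => if q.2.2.2 then z.im else z.re) (((Real.sqrt 2 : ℂ) • ((fundamentalLatticeRep 2).lieProj (noiseDir n.2) * (fun (ee : Edge 3 L) => Matrix.of fun (i j : Fin (fundamentalLatticeRep 2).N) => ((y (ee, i, j, false) : ℝ) : ℂ) + ((y (ee, i, j, true) : ℝ) : ℂ) * Complex.I) q.1)) q.2.1 q.2.2.1) else 0) := fun n y => hs n y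
  have hRic2 : ∀ (Λ : (Edge 3 L × Fin 2 × Fin 2 × Bool → ℝ) →L[ℝ] ℝ) (y : (Edge 3 L × Fin 2 × Fin 2 × Bool → ℝ)),
      (1 / 4 : ℝ) * ∑ n, ∑ m, (Λ (s2 m (s2 n y) - s2 n (s2 m y))) ^ 2 = 2 * ∑ n, (Λ (s2 n y)) ^ 2 := fun Λ y => hRic Λ y
  -- the ambient frame carré `Gu = Σ_n (W_n u)²` and its regularity
  set Gu : (Edge 3 L × Fin 2 × Fin 2 × Bool → ℝ) → ℝ := fun z => ∑ n, (fderiv ℝ u z (s2 n z)) ^ 2 with hGu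
  have hGu_eq : (fun z : (Edge 3 L × Fin 2 × Fin 2 × Bool → ℝ) => ∑ n : Edge 3 L × NoiseIdx (fundamentalLatticeRep 2).N, (fderiv ℝ u z (fun q : Edge 3 L × Fin (fundamentalLatticeRep 2).N × Fin (fundamentalLatticeRep 2).N × Bool => if n.1 = q.1 then (fun z : ℂ => if q.2.2.2 then z.im else z.re) (((Real.sqrt 2 : ℂ) • ((fundamentalLatticeRep 2).lieProj (noiseDir n.2) * (fun (ee : Edge 3 L) => Matrix.of fun (i j : Fin (fundamentalLatticeRep 2).N) => ((z (ee, i, j, false) : ℝ) : ℂ) + ((z (ee, i, j, true) : ℝ) : ℂ) * Complex.I) q.1)) q.2.1 q.2.2.1) else 0)) ^ 2) = Gu := by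
    funext z
    show (∑ n : Edge 3 L × NoiseIdx (fundamentalLatticeRep 2).N, (fderiv ℝ u z (fun q : Edge 3 L × Fin (fundamentalLatticeRep 2).N × Fin (fundamentalLatticeRep 2).N × Bool => if n.1 = q.1 then (fun z : ℂ => if q.2.2.2 then z.im else z.re) (((Real.sqrt 2 : ℂ) • ((fundamentalLatticeRep 2).lieProj (noiseDir n.2) * (fun (ee : Edge 3 L) => Matrix.of fun (i j : Fin (fundamentalLatticeRep 2).N) => ((z (ee, i, j, false) : ℝ) : ℂ) + ((z (ee, i, j, true) : ℝ) : ℂ) * Complex.I) q.1)) q.2.1 q.2.2.1) else 0)) ^ 2) = ∑ n, (fderiv ℝ u z (s2 n z)) ^ 2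
    refine Finset.sum_congr rfl fun n _ => ?_
    rw [hs2 n z]
  have hGuC : ContDiff ℝ 2 Gu := ContDiff.sum fun n _ => (contDiff_frameDeriv (k := 2) hu (s2 n)).pow 2
  -- the generator in frame form
  have hD : ∀ φ : (Edge 3 L × Fin 2 × Fin 2 × Bool → ℝ) → ℝ, ContDiff ℝ 2 φ → ∀ V : (GaugeConfig 3 L (Matrix.specialUnitaryGroup (Fin 2) ℂ)), gen φ V = 1 / 2 * ∑ n : Edge 3 L × NoiseIdx (fundamentalLatticeRep 2).N,
      (fderiv ℝ (fun w => fderiv ℝ φ w (s2 n w)) (coords V) (s2 n (coords V)) +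
        fderiv ℝ ψ (coords V) (s2 n (coords V)) * fderiv ℝ φ (coords V) (s2 n (coords V))) :=
    fun φ hφ V => generator_eq_half_frameGen L β' s hs hCas φ hφ V
  -- the frame generator of `u` (ambient, `C¹`) and `2v` agree on the group, hence so do their frame derivatives
  set Lu : (Edge 3 L × Fin 2 × Fin 2 × Bool → ℝ) → ℝ := fun z => ∑ m, (fderiv ℝ (fun w => fderiv ℝ u w (s2 m w)) z (s2 m z) +
      fderiv ℝ ψ z (s2 m z) * fderiv ℝ u z (s2 m z)) with hLu
  have hLuC : ContDiff ℝ 1 Lu := contDiff_frameGen (k := 1) hu hψC s2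
  have hLu_group : ∀ V' : (GaugeConfig 3 L (Matrix.specialUnitaryGroup (Fin 2) ℂ)), Lu (coords V') = (fun z => 2 * v z) (coords V') := by
    intro V'
    show Lu (coords V') = 2 * v (coords V')
    rw [huv V', hD u hu2 V', hLu]
    ring
  have hWLu : ∀ n : Edge 3 L × NoiseIdx (fundamentalLatticeRep 2).N, fderiv ℝ Lu (coords V) (s2 n (coords V)) = 2 * fderiv ℝ v (coords V) (s2 n (coords V)) := by
    intro n
    have h2v : Differentiable ℝ (fun z : (Edge 3 L × Fin 2 × Fin 2 × Bool → ℝ) => 2 * v z) := (hv.differentiable (by norm_num)).const_mul 2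
    have h : fderiv ℝ Lu (coords V) (fun q : Edge 3 L × Fin (fundamentalLatticeRep 2).N × Fin (fundamentalLatticeRep 2).N × Bool => if n.1 = q.1 then (fun z : ℂ => if q.2.2.2 then z.im else z.re) (((Real.sqrt 2 : ℂ) • ((fundamentalLatticeRep 2).lieProj (noiseDir n.2) * (fun (ee : Edge 3 L) => Matrix.of fun (i j : Fin (fundamentalLatticeRep 2).N) => ((coords V (ee, i, j, false) : ℝ) : ℂ) + ((coords V (ee, i, j, true) : ℝ) : ℂ) * Complex.I) q.1)) q.2.1 q.2.2.1) else 0) = fderiv ℝ (fun z : (Edge 3 L × Fin 2 × Fin 2 × Bool → ℝ) => 2 * v z) (coords V) (fun q : Edge 3 L × Fin (fundamentalLatticeRep 2).N × Fin (fundamentalLatticeRep 2).N × Bool => if n.1 = q.1 then (fun z : ℂ => if q.2.2.2 then z.im else z.re) (((Real.sqrt 2 : ℂ) • ((fundamentalLatticeRep 2).lieProj (noiseDir n.2) * (fun (ee : Edge 3 L) => Matrix.of fun (i j : Fin (fundamentalLatticeRep 2).N) => ((coords V (ee, i, j, false) : ℝ) : ℂ) + ((coords V (ee, i, j, true) : ℝ)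 : ℂ) * Complex.I) q.1)) q.2.1 q.2.2.1) else 0) :=
      frameDeriv_eq_of_comp_coords_eq (L := L) n (hLuC.differentiable (by norm_num)) h2v hLu_group V
    rw [hs2 n (coords V), h, fderiv_const_mul ((hv.differentiable (by norm_num)) _) (2 : ℝ), _root_.smul_apply, smul_eq_mul]
  -- Bochner, pointwise
  have hB := frameGammaTwo_pointwise hu hψC s2 c hbr2 hanti (coords V)
  -- curvature: Ricci part `2Γ`, Hessian part `≥ −K₀Γ`
  have hpt : (2 - K₀) * ∑ n, (fderiv ℝ u (coords V) (s2 n (coords V))) ^ 2 ≤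
      ∑ n, ∑ m, (fderiv ℝ (fun z => fderiv ℝ u z (s2 n z)) (coords V) (s2 m (coords V))) ^ 2 -
        ∑ n, ∑ m, fderiv ℝ u (coords V) (s2 n (coords V)) * fderiv ℝ u (coords V) (s2 m (coords V)) * fderiv ℝ (fun z => fderiv ℝ ψ z (s2 m z)) (coords V) (s2 n (coords V)) := by
    have hq := quarter_sum_sum_sq_bracket_le hu2 s2 (coords V)
    have hr := hRic2 (fderiv ℝ u (coords V)) (coords V)
    have hH : ∑ n, ∑ m, fderiv ℝ u (coords V) (s2 n (coords V)) * fderiv ℝ u (coords V) (s2 m (coords V)) * fderiv ℝ (fun z => fderiv ℝ ψ z (s2 m z)) (coords V) (s2 n (coords V)) ≤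
        K₀ * ∑ n, (fderiv ℝ u (coords V) (s2 n (coords V))) ^ 2 := by
      have h := hHess V (fderiv ℝ u (coords V))
      have hsV : ∀ k : Edge 3 L × NoiseIdx (fundamentalLatticeRep 2).N, s2 k (coords V) = (fun q : Edge 3 L × Fin (fundamentalLatticeRep 2).N × Fin (fundamentalLatticeRep 2).N × Bool => if k.1 = q.1 then (fun z : ℂ => if q.2.2.2 then z.im else z.re) (((Real.sqrt 2 : ℂ) • ((fundamentalLatticeRep 2).lieProj (noiseDir k.2) * (fun (ee : Edge 3 L) => Matrix.of fun (i j : Fin (fundamentalLatticeRep 2).N) => ((coords V (ee, i, j, false) : ℝ) : ℂ) + ((coords V (ee, i, j, true) : ℝ) : ℂ) * Complex.I) q.1)) q.2.1 q.2.2.1) else 0) := fun k => hs2 k (coords V)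
      have hsz : ∀ k : Edge 3 L × NoiseIdx (fundamentalLatticeRep 2).N, (fun z : (Edge 3 L × Fin 2 × Fin 2 × Bool → ℝ) => fderiv ℝ ψ z (s2 k z)) =
          fun z : (Edge 3 L × Fin 2 × Fin 2 × Bool → ℝ) => fderiv ℝ ψ z (fun q : Edge 3 L × Fin (fundamentalLatticeRep 2).N × Fin (fundamentalLatticeRep 2).N × Bool => if k.1 = q.1 then (fun z : ℂ => if q.2.2.2 then z.im else z.re) (((Real.sqrt 2 : ℂ) • ((fundamentalLatticeRep 2).lieProj (noiseDir k.2) * (fun (ee : Edge 3 L) => Matrix.of fun (i j : Fin (fundamentalLatticeRep 2).N) => ((z (ee, i, j, false) : ℝ) : ℂ) + ((z (ee, i, j, true) : ℝ) : ℂ) * Complex.I) q.1)) q.2.1 q.2.2.1) else 0) := fun k => funext fun z => congrArg (fderiv ℝ ψ z) (hs2 k z)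
      simp_rw [hsz, hsV]
      exact h
    have hsymm : ∑ n, ∑ m, (fderiv ℝ (fun z => fderiv ℝ u z (s2 n z)) (coords V) (s2 m (coords V))) ^ 2 =
        ∑ n, ∑ m, (fderiv ℝ (fun z => fderiv ℝ u z (s2 m z)) (coords V) (s2 n (coords V))) ^ 2 := Finset.sum_comm
    rw [hsymm]
    nlinarith [hq, hr, hH]
  -- dictionary for the two carrés du champ
  have hΓuu : ∑ i : Edge 3 L × Fin 2 × Fin 2 × Bool, ∑ j : Edge 3 L × Fin 2 × Fin 2 × Bool,
      fderiv ℝ u (coords V) (Pi.single i 1) * fderiv ℝ u (coords V) (Pi.single j 1) * A V i j = ∑ n, (fderiv ℝ u (coords V) (s2 n (coords V))) ^ 2 := by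
    have h : ∑ i : Edge 3 L × Fin 2 × Fin 2 × Bool, ∑ j : Edge 3 L × Fin 2 × Fin 2 × Bool,
        fderiv ℝ u (coords V) (Pi.single i 1) * fderiv ℝ u (coords V) (Pi.single j 1) * A V i j =
        ∑ n : Edge 3 L × NoiseIdx (fundamentalLatticeRep 2).N, fderiv ℝ u (coords V) (fun q : Edge 3 L × Fin (fundamentalLatticeRep 2).N × Fin (fundamentalLatticeRep 2).N × Bool => if n.1 = q.1 then (fun z : ℂ => if q.2.2.2 then z.im else z.re) (((Real.sqrt 2 : ℂ) • ((fundamentalLatticeRep 2).lieProj (noiseDir n.2) * (fun (ee : Edge 3 L) => Matrix.of fun (i j : Fin (fundamentalLatticeRep 2).N) => ((coords V (ee, i, j, false) : ℝ) : ℂ) + ((coords V (ee, i, j, true) : ℝ) : ℂ) * Complex.I) q.1)) q.2.1 q.2.2.1) else 0) * fderiv ℝ u (coords V) (fun q : Edge 3 L × Fin (fundamentalLatticeRep 2).N × Fin (fundamentalLatticeRep 2).N × Bool => if n.1 = q.1 then (fun z : ℂ => if q.2.2.2 then z.im else z.re) (((Real.sqrt 2 : ℂ) • ((fundamentalLatticeRep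 2).lieProj (noiseDir n.2) * (fun (ee : Edge 3 L) => Matrix.of fun (i j : Fin (fundamentalLatticeRep 2).N) => ((coords V (ee, i, j, false) : ℝ) : ℂ) + ((coords V (ee, i, j, true) : ℝ) : ℂ) * Complex.I) q.1)) q.2.1 q.2.2.1) else 0) :=
      carre_eq_sum_frameDeriv_mul L β' u u V
    rw [h]
    refine Finset.sum_congr rfl fun n _ => ?_
    rw [← hs2 n (coords V), sq]
  have hΓuv : ∑ i : Edge 3 L × Fin 2 × Fin 2 × Bool, ∑ j : Edge 3 L × Fin 2 × Fin 2 × Bool,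
      fderiv ℝ u (coords V) (Pi.single i 1) * fderiv ℝ v (coords V) (Pi.single j 1) * A V i j = ∑ n, fderiv ℝ u (coords V) (s2 n (coords V)) * fderiv ℝ v (coords V) (s2 n (coords V)) := by
    have h : ∑ i : Edge 3 L × Fin 2 × Fin 2 × Bool, ∑ j : Edge 3 L × Fin 2 × Fin 2 × Bool,
        fderiv ℝ u (coords V) (Pi.single i 1) * fderiv ℝ v (coords V) (Pi.single j 1) * A V i j =
        ∑ n : Edge 3 L × NoiseIdx (fundamentalLatticeRep 2).N, fderiv ℝ u (coords V) (fun q : Edge 3 L × Fin (fundamentalLatticeRep 2).N × Fin (fundamentalLatticeRep 2).N × Bool => if n.1 = q.1 then (fun z : ℂ => if q.2.2.2 then z.im else z.re) (((Real.sqrt 2 : ℂ) • ((fundamentalLatticeRep 2).lieProj (noiseDir n.2) * (fun (ee : Edge 3 L) => Matrix.of fun (i j : Fin (fundamentalLatticeRep 2).N) => ((coords V (ee, i, j, false) : ℝ) : ℂ) + ((coords V (ee, i, j, true) : ℝ) : ℂ) * Complex.I) q.1)) q.2.1 q.2.2.1) else 0) * fderiv ℝ v (coords V) (fun q : Edge 3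 L × Fin (fundamentalLatticeRep 2).N × Fin (fundamentalLatticeRep 2).N × Bool => if n.1 = q.1 then (fun z : ℂ => if q.2.2.2 then z.im else z.re) (((Real.sqrt 2 : ℂ) • ((fundamentalLatticeRep 2).lieProj (noiseDir n.2) * (fun (ee : Edge 3 L) => Matrix.of fun (i j : Fin (fundamentalLatticeRep 2).N) => ((coords V (ee, i, j, false) : ℝ) : ℂ) + ((coords V (ee, i, j, true) : ℝ) : ℂ) * Complex.I) q.1)) q.2.1 q.2.2.1) else 0) :=
      carre_eq_sum_frameDeriv_mul L β' u v V
    rw [h]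
    refine Finset.sum_congr rfl fun n _ => ?_
    rw [← hs2 n (coords V)]
  -- assemble
  rw [hGu_eq, hΓuu, hΓuv, hD Gu hGuC V]
  have hcross : ∑ n, fderiv ℝ u (coords V) (s2 n (coords V)) * fderiv ℝ Lu (coords V) (s2 n (coords V)) = 2 * ∑ n, fderiv ℝ u (coords V) (s2 n (coords V)) * fderiv ℝ v (coords V) (s2 n (coords V)) := by
    rw [Finset.mul_sum]
    refine Finset.sum_congr rfl fun n _ => ?_
    rw [hWLu n]; ring
  have hB' : 1 / 2 * ∑ n, (fderiv ℝ (fun z => fderiv ℝ Gu z (s2 n z)) (coords V) (s2 n (coords V)) + fderiv ℝ ψ (coords V) (s2 n (coords V)) * fderiv ℝ Gu (coords V) (s2 n (coords V))) -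
      ∑ n, fderiv ℝ u (coords V) (s2 n (coords V)) * fderiv ℝ Lu (coords V) (s2 n (coords V)) =
      ∑ n, ∑ m, (fderiv ℝ (fun z => fderiv ℝ u z (s2 n z)) (coords V) (s2 m (coords V))) ^ 2 -
        ∑ n, ∑ m, fderiv ℝ u (coords V) (s2 n (coords V)) * fderiv ℝ u (coords V) (s2 m (coords V)) * fderiv ℝ (fun z => fderiv ℝ ψ z (s2 m z)) (coords V) (s2 n (coords V)) := hB
  rw [hcross] at hB'
  linarith [hpt, hB']

end Summit.QuantumFields.YangMills.Theorems.ColdStartUniversality
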